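import Summits.QuantumFields.BalabanUV.Beta.EriceRemainderEnclosureHistoryAutonomyComparisonAgeCompositionTwoAgesFar

/-!
# EriceRemainderEnclosureHistoryAutonomyComparisonAgeCompositionYoungBelowCluster — (E91c) route (N), first order: ONE YOUNG AGE FAR BELOW AN ARBITRARY OLD
# CLUSTER.  The mechanism of (E91b) with the old side a CLUSTER: for a profile carried by one young age `i` and any set of old ages `≥ k₀`, along every
# admissible flow, every horizon and every damping of the self-consistent class `g_t(1+F_t) ≥ 1`: IF the old cluster's total window load is at most
# `1 − δ` at every pin and `δ·k₀ ≥ 10·i`, THEN `0 ≤ ε ≤ e` — whatever the TOTAL load (young + old may exceed 1).  Corollary: the census three ages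
# `{1, k₂, k₃}` with `x₂ + x₃ ≤ 1 − δ` at every pin and `k₂ ≥ 10∕δ` (wedge R1 of README g82∕e91 §2(c); the load hypothesis is DISPLAYED, not discharged —
# the typed pair bounds give `δ > 0` only below ratio 133)

Cell `pub-balaban`, β-function sub-cell, BINDER row D4 «RemainderConst leaves for Bałaban's split» (`HOME/BINDER-OWNERS.md`; owner lineage `b2b-balaban-beta-an4`;
this file by co-owner #2 lineage `b2b-balaban-beta-d4-p2`, generation 82), β-FLOW TEAM duty (1), FREEZE (0) honoured (def-free; nothing restated).

HONEST FRAMING (page 1, verbatim and binding).  *"Discharging BetaPertH makes Bałaban's UV stability UNCONDITIONAL — a real constructive-QFT result; it is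
NOT the continuum limit and NOT the Clay problem."*  THIS FILE DISCHARGES NOTHING OF THE KIND.  Elementary real algebra ∕ real analysis about ABSTRACT
functionals on a box ]0,γ]^ℕ with displayed floors, profiles and signs, and the FIRST-ORDER renewal objects of route (N) built from them — hypotheses of a
census, not facts; the form, signs, ages and moments of Bałaban's (1.22) limit functional are NOT PRINTED ([I] p. 298; GAPS G-t4-U2-1∕-2) and NOT asserted.
Row D4 class UNCHANGED (critical-path width 0; instance 0∕1; D4 DISCHARGE NO DATE).  HONEST DEPENDENCY: continuum YM on T⁴ ⇐ BetaPertH ∧ nine spine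
estimates (0/9 proved); BetaPertH ⇐ (D1) ∧ (D4) ∧ CAP+tail; G-an2-4 gates asym, D1 and NE2/3/4.

THE POINT (README `HOME/b2b-balaban-beta-d4-p2/g82/e91/README.md` §2, §5(2)).  (E91b)'s pure lemma `renewal_nonneg_two_reads` does not care how many ages form the old
read: with `O = Σ_{j ≥ k₀}` (reads of the cluster), `O ≤ (Σ_{j≥k₀} x_j)·e ≤ (1−δ)e` and, summing (E91a) `old_read_variation` over the cluster,
`O(m) − O(m+d) ≤ 4d·Σ_j c_j(m)·e_m ≤ (4d∕k₀)·(Σ_j x_j(m))·e_m ≤ (4i∕k₀)(1−δ)e_m`; the young row is `≤ x_i ≤ √2∕2`; the condition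
`(√2∕2)·(4i∕k₀)(1−δ) ≤ (1−√2∕2)·δ` follows from `δk₀ ≥ 10i` (`2√2 < 10(1 − √2∕2) = 2.93`).  Uses (E91a) `old_read_variation`, (E91b) `renewal_nonneg_two_reads`,
(E82a) `kernel_entry_le`∕`row_mass_le`, (E89b) `window_load_le_sqrt_two_div_two`, (E80b) `aggregate_eq_sum` BY NAME.  NOT CLAIMED: the load hypothesis along flows
(it is the census letter `x₂ + x₃ ≤ 1 − δ`; typed pair bounds (E90c) give it with `δ > 0` only for ratios `< 133`); anything printed — NOT B12 Thm 2, NOT BetaPertH.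

WHAT IS PROVED ([folklore]; 0 `def`, 0 sorry).  `cluster_row_le`, `cluster_lagZero_le`, **`flow_nonneg_young_below_cluster`**, **`flow_nonneg_three_ages_far_middle`**
(wedge R1: light old pair, `k₂ ≥ 10∕δ`), **`flow_nonneg_three_ages_far_old`** (wedge R2: light young pair, `k₃ ≥ 10k₂∕δ`).
-/
noncomputable section
open Finset

namespace Summit.QuantumFields.BalabanUV.Beta.EriceRemainderEnclosureHistoryAutonomyComparisonAgeCompositionYoungBelowCluster

open Literature.MathematicalPhysics.QuantumFieldTheory.Balaban1983to89
open Literature.MathematicalPhysics.QuantumFieldTheory.Balaban1983to89.T4BetaStationary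
open Literature.MathematicalPhysics.QuantumFieldTheory.Balaban1983to89.T4BetaFlowWellPosed
open Summit.QuantumFields.BalabanUV.Beta.EriceRemainderEnclosureHistoryAutonomyComparisonAgeCompositionThreeAgesMassCap
  (window_load_le_sqrt_two_div_two)
open Summit.QuantumFields.BalabanUV.Beta.EriceRemainderEnclosureHistoryAutonomyComparisonAgeCompositionYoungestTailSumFlow
  (kernel_entry_le row_mass_le)
open Summit.QuantumFields.BalabanUV.Beta.EriceRemainderEnclosureHistoryAutonomyComparisonAgeCompositionChainWiring (aggregate_eq_sum)
open Summit.QuantumFields.BalabanUV.Beta.EriceRemainderEnclosureHistoryAutonomyComparisonAgeCompositionTwoAgesOldRead (old_read_variation)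
open Summit.QuantumFields.BalabanUV.Beta.EriceRemainderEnclosureHistoryAutonomyComparisonAgeCompositionTwoAgesFar (renewal_nonneg_two_reads)

variable {B : (ℕ → ℝ) → ℝ} {γ b gIR : ℝ} {L : ℕ → ℝ} {K : ℕ} {h g : ℕ → ℝ}

/-- The damped rows of a cluster of ages `[k₀, K)` sum to at most the cluster's total window load:
`Σ_{l<K} Σ_{j∈[k₀,K)} KL j m l ≤ Σ_{j∈[k₀,K)} j·(L_jh_{m+j}³∕2)` ((E82a) `row_mass_le` per age). [folklore] -/
theorem cluster_row_le (hL : ∀ k, 0 ≤ L k) (hh : SeqBox γ h) (hg : ∀ t, 0 < g t ∧ g t ≤ 1) {KL : ℕ → ℕ → ℕ → ℝ}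
    (hKL : ∀ k n l, KL k n l = if 0 < k ∧ k < K ∧ l < k then L k * h (n + k) ^ 3 / 2 * ∏ t ∈ Ico (n + 1 + l) (n + k + 1), g t else 0)
    (k₀ m : ℕ) :
    ∑ l ∈ range K, ∑ j ∈ Ico k₀ K, KL j m l ≤ ∑ j ∈ Ico k₀ K, (j : ℝ) * (L j * h (m + j) ^ 3 / 2) := by
  rw [sum_comm]
  exact sum_le_sum fun j hj => row_mass_le hL hh hg hKL (mem_Ico.mp hj).2 m

/-- The lag-zero coefficients of a cluster of ages `≥ k₀ ≥ 1` are at most `1∕k₀` of its total window load: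
`Σ_{j∈[k₀,K)} L_jh_{m+j}³∕2 ≤ (1∕k₀)·Σ_{j∈[k₀,K)} j·(L_jh_{m+j}³∕2)`. [folklore] -/
theorem cluster_lagZero_le (hL : ∀ k, 0 ≤ L k) (hh : SeqBox γ h) {k₀ : ℕ} (hk0 : 1 ≤ k₀) (m : ℕ) :
    ∑ j ∈ Ico k₀ K, L j * h (m + j) ^ 3 / 2 ≤ (1 / (k₀ : ℝ)) * ∑ j ∈ Ico k₀ K, (j : ℝ) * (L j * h (m + j) ^ 3 / 2) := by
  have hk0r : (0 : ℝ) < k₀ := by exact_mod_cast hk0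
  rw [mul_sum]
  refine sum_le_sum fun j hj => ?_
  have hjr : (k₀ : ℝ) ≤ j := by exact_mod_cast (mem_Ico.mp hj).1
  have hc : 0 ≤ L j * h (m + j) ^ 3 / 2 := by have := hL j; have := (hh (m + j)).1; positivity
  have h1 : (1 : ℝ) ≤ (j : ℝ) / k₀ := by rw [le_div_iff₀ hk0r]; linarith
  calc L j * h (m + j) ^ 3 / 2 = (L j * h (m + j) ^ 3 / 2) * 1 := by ring
    _ ≤ (L j * h (m + j) ^ 3 / 2) * ((j : ℝ) / k₀) := mul_le_mul_of_nonneg_left h1 hc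
    _ = 1 / (k₀ : ℝ) * ((j : ℝ) * (L j * h (m + j) ^ 3 / 2)) := by field_simp

/-- **ONE YOUNG AGE FAR BELOW AN ARBITRARY OLD CLUSTER — EVERY HORIZON, EVERY DAMPING OF THE SELF-CONSISTENT CLASS, WHATEVER THE TOTAL LOAD.**  Profile
carried by `{i} ∪ [k₀, K)` with `1 ≤ i < k₀ ≤ K` (`L_j = 0` for the other ages `< K`); dampings with `g_t(1 + F_t) ≥ 1`; `0 < δ ≤ 1`; IF the old cluster's
total window load is `≤ 1 − δ` at every pin and `10·i ≤ δ·k₀`, THEN `0 ≤ ε ≤ e` at every pin for every admissible excess ((E91b) `renewal_nonneg_two_reads`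
with `sy = √2∕2`, `so = 1 − δ`, `V = 4i(1−δ)∕k₀`). [folklore] -/
theorem flow_nonneg_young_below_cluster (hmono : ∀ u v : ℕ → ℝ, SeqBox γ u → SeqBox γ v → (∀ j, u j ≤ v j) → B u ≤ B v)
    (hL : ∀ k, 0 ≤ L k) (hb : 0 < b) (hlo : ∀ u, SeqBox γ u → b ≤ B u) (hdom : ∀ u, SeqBox γ u → ∑ k ∈ range K, L k * u k ≤ B u)
    (hh : SeqBox γ h) (hf : MemFlow B gIR h) (hg : ∀ t, 0 < g t ∧ g t ≤ 1)
    (hgF : ∀ t, 1 ≤ g t * (1 + ∑ k ∈ range K, L k * h (t + k) ^ 3 / 2))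
    {i k₀ : ℕ} (hi : 1 ≤ i) (hik : i < k₀) (hk0K : k₀ ≤ K) (hLs : ∀ l, l < K → l ≠ i → l < k₀ → L l = 0)
    {δ : ℝ} (hδ : 0 < δ) (hδ1 : δ ≤ 1) (hfar : (10 : ℝ) * i ≤ δ * k₀)
    (hold : ∀ m, ∑ j ∈ Ico k₀ K, (j : ℝ) * (L j * h (m + j) ^ 3 / 2) ≤ 1 - δ)
    {N : ℕ} {KL : ℕ → ℕ → ℕ → ℝ}
    (hKL : ∀ k n l, KL k n l = if 0 < k ∧ k < K ∧ l < k then L k * h (n + k) ^ 3 / 2 * ∏ t ∈ Ico (n + 1 + l) (n + k + 1), g t else 0)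
    {KA : ℕ → ℕ → ℕ → ℝ} {RA : ℕ → (ℕ → ℝ) → ℕ → ℝ}
    (hRA : ∀ i v m, RA i v m = ∑ l ∈ range K, KA i m l * v (m + 1 + l))
    (hKA : ∀ i m l, KA i m l = KL i m l + KA (i + 1) m l) (hKAtop : ∀ m l, KA K m l = 0)
    {e ε : ℕ → ℝ} (he0 : ∀ m, 0 ≤ e m) (hea : ∀ m, e (m + 1) ≤ e m)
    (hεt : ∀ m, N < m → ε m = 0) (hεrec : ∀ m, ε m = e m - RA 1 ε m) : ∀ m, 0 ≤ ε m ∧ ε m ≤ e m := by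
  have hpos : ∀ n, 0 < h n := fun n => (hh n).1
  have hs2 : Real.sqrt 2 ^ 2 = 2 := Real.sq_sqrt (by norm_num)
  have hs0 : 0 ≤ Real.sqrt 2 := Real.sqrt_nonneg 2
  have hs17 : Real.sqrt 2 ≤ 17 / 12 := Real.sqrt_le_iff.mpr ⟨by norm_num, by norm_num⟩
  have hir : (1 : ℝ) ≤ i := by exact_mod_cast hi
  have hk0r : (0 : ℝ) < k₀ := by exact_mod_cast (Nat.lt_of_lt_of_le Nat.zero_lt_one (le_trans hi hik.le))
  have hiK : i < K := lt_of_lt_of_le hik hk0K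
  have hK : 1 ≤ K := by omega
  have hL0 : L 0 = 0 := hLs 0 (by omega) (by omega) (by omega)
  -- the aggregate row is the young row plus the cluster's rows
  have hKA1 : ∀ m l, KA 1 m l = KL i m l + ∑ j ∈ Ico k₀ K, KL j m l := by
    intro m l
    have h1 : KA 1 m l = ∑ k' ∈ Ico 1 (K - 1 + 1), KL k' m l :=
      aggregate_eq_sum (n := K - 1) hKA (fun m l => by rw [Nat.sub_add_cancel hK]; exact hKAtop m l) (show 1 ≤ K - 1 + 1 by omega) m l
    rw [h1, Nat.sub_add_cancel hK, ← sum_Ico_consecutive _ (show 1 ≤ k₀ by omega) hk0K]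
    congr 1
    exact sum_eq_single_of_mem i (mem_Ico.mpr ⟨hi, hik⟩) fun j hj hji => by
      rw [hKL]
      split_ifs
      · rw [hLs j (by have := (mem_Ico.mp hj).2; omega) hji (mem_Ico.mp hj).2]; simp
      · rfl
  have hWy : ∀ m, ∑ l ∈ range K, KL i m l ≤ Real.sqrt 2 / 2 := fun m =>
    (row_mass_le hL hh hg hKL hiK m).trans (window_load_le_sqrt_two_div_two hmono hL hb hlo hdom hh hf hiK m)
  refine renewal_nonneg_two_reads (i := i) (N := N) (Kw := K) (sy := Real.sqrt 2 / 2) (so := 1 - δ) (V := 4 * i * (1 - δ) / k₀)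
    (wy := fun m l => KL i m l) (wo := fun m l => ∑ j ∈ Ico k₀ K, KL j m l)
    (Y := fun m => ∑ l ∈ range K, KL i m l * ε (m + 1 + l)) (O := fun m => ∑ l ∈ range K, (∑ j ∈ Ico k₀ K, KL j m l) * ε (m + 1 + l))
    (fun m l => (kernel_entry_le hL hh hg hKL i m l).1) (fun m l hl => by rw [hKL, if_neg (by omega)]) hWy
    (fun m l => sum_nonneg fun j _ => (kernel_entry_le hL hh hg hKL j m l).1)
    (fun m => (cluster_row_le hL hh hg hKL k₀ m).trans (hold m))
    (by linarith [hs17]) (by linarith) (by positivity) ?_ (fun _ => rfl) (fun _ => rfl) he0 hea ?_ hεt ?_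
  · -- the condition: (√2∕2)·(4i(1−δ)∕k₀) ≤ (1 − √2∕2)·δ  ⟸  10 i ≤ δ k₀
    rw [show (1 : ℝ) - (1 - δ) = δ by ring]
    have h1 : Real.sqrt 2 / 2 * (4 * i * (1 - δ) / k₀) = (2 * Real.sqrt 2 * i * (1 - δ)) / k₀ := by ring
    rw [h1, div_le_iff₀ hk0r]
    -- 2√2·i(1−δ) ≤ 2√2·i ≤ (1 − √2∕2)·10 i ≤ (1−√2∕2)·δk₀
    have h2 : 2 * Real.sqrt 2 * i * (1 - δ) ≤ 2 * Real.sqrt 2 * i := by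
      have : 0 ≤ 2 * Real.sqrt 2 * i * δ := by positivity
      nlinarith
    have h3 : 2 * Real.sqrt 2 ≤ (1 - Real.sqrt 2 / 2) * 10 := by nlinarith [hs17]
    have h4 : 2 * Real.sqrt 2 * i ≤ (1 - Real.sqrt 2 / 2) * (10 * i) := by nlinarith [h3]
    have h5 : (1 - Real.sqrt 2 / 2) * (10 * i) ≤ (1 - Real.sqrt 2 / 2) * (δ * k₀) :=
      mul_le_mul_of_nonneg_left hfar (by linarith [hs17])
    linarith
  · -- the cluster's read varies slowly: sum (E91a) over the cluster
    intro m d hd1 hdi IH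
    have hem := he0 m
    have e1 : ∀ p, ∑ l ∈ range K, (∑ j ∈ Ico k₀ K, KL j p l) * ε (p + 1 + l)
        = ∑ j ∈ Ico k₀ K, ∑ l ∈ range K, KL j p l * ε (p + 1 + l) := fun p => by
      simp only [sum_mul]; rw [sum_comm]
    show ∑ l ∈ range K, (∑ j ∈ Ico k₀ K, KL j m l) * ε (m + 1 + l)
        - ∑ l ∈ range K, (∑ j ∈ Ico k₀ K, KL j (m + d) l) * ε (m + d + 1 + l) ≤ 4 * i * (1 - δ) / k₀ * e m
    rw [e1 m, e1 (m + d), ← sum_sub_distrib]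
    have hstep : ∀ j ∈ Ico k₀ K, ∑ l ∈ range K, KL j m l * ε (m + 1 + l) - ∑ l ∈ range K, KL j (m + d) l * ε (m + d + 1 + l)
        ≤ 4 * d * (L j * h (m + j) ^ 3 / 2) * e m := fun j hj =>
      old_read_variation hmono hL hb hlo hdom hh hf hL0 hg hgF hKL (by have := (mem_Ico.mp hj).1; omega) (mem_Ico.mp hj).2 hd1
        (by have := (mem_Ico.mp hj).1; omega) he0 hea IH
    refine (sum_le_sum hstep).trans ?_
    rw [← sum_mul, ← mul_sum]
    -- 4d·Σ c_j ≤ 4i·(1∕k₀)·Σ j c_j ≤ 4 i (1−δ)∕k₀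
    have hc := cluster_lagZero_le (K := K) hL hh (show 1 ≤ k₀ by omega) m
    have hsum0 : 0 ≤ ∑ j ∈ Ico k₀ K, L j * h (m + j) ^ 3 / 2 :=
      sum_nonneg fun j _ => by have := hL j; have := hpos (m + j); positivity
    have hdr : (d : ℝ) ≤ i := by exact_mod_cast hdi
    have hd0 : (0 : ℝ) ≤ d := Nat.cast_nonneg d
    calc 4 * (d : ℝ) * (∑ j ∈ Ico k₀ K, L j * h (m + j) ^ 3 / 2) * e m
        ≤ 4 * (i : ℝ) * ((1 / (k₀ : ℝ)) * (1 - δ)) * e m := by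
          refine mul_le_mul_of_nonneg_right ?_ hem
          have h1 : ∑ j ∈ Ico k₀ K, L j * h (m + j) ^ 3 / 2 ≤ (1 / (k₀ : ℝ)) * (1 - δ) :=
            hc.trans (mul_le_mul_of_nonneg_left (hold m) (by positivity))
          nlinarith [mul_le_mul hdr h1 hsum0 (by positivity)]
      _ = 4 * i * (1 - δ) / k₀ * e m := by field_simp
  · intro m
    rw [hεrec m, hRA]
    have : ∑ l ∈ range K, KA 1 m l * ε (m + 1 + l)
        = ∑ l ∈ range K, KL i m l * ε (m + 1 + l) + ∑ l ∈ range K, (∑ j ∈ Ico k₀ K, KL j m l) * ε (m + 1 + l) := by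
      rw [← sum_add_distrib]; exact sum_congr rfl fun l _ => by rw [hKA1]; ring
    rw [this]; ring

/-- **THE CENSUS THREE AGES WITH A LIGHT OLD PAIR (wedge R1).**  Profile carried by `{1, k₂, k₃}`, `2 ≤ k₂ < k₃ < K`; dampings of the self-consistent
class; IF `x₂(m) + x₃(m) ≤ 1 − δ` at every pin (`x_j(m) = j·L_jh_{m+j}³∕2`; DISPLAYED, not discharged) with `0 < δ ≤ 1` and `10 ≤ δ·k₂`, THEN `0 ≤ ε ≤ e`
for every admissible excess, every horizon — whatever `d + x₂ + x₃` (`flow_nonneg_young_below_cluster` with `i = 1`, `k₀ = k₂`). [folklore] -/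
theorem flow_nonneg_three_ages_far_middle (hmono : ∀ u v : ℕ → ℝ, SeqBox γ u → SeqBox γ v → (∀ j, u j ≤ v j) → B u ≤ B v)
    (hL : ∀ k, 0 ≤ L k) (hb : 0 < b) (hlo : ∀ u, SeqBox γ u → b ≤ B u) (hdom : ∀ u, SeqBox γ u → ∑ k ∈ range K, L k * u k ≤ B u)
    (hh : SeqBox γ h) (hf : MemFlow B gIR h) (hg : ∀ t, 0 < g t ∧ g t ≤ 1)
    (hgF : ∀ t, 1 ≤ g t * (1 + ∑ k ∈ range K, L k * h (t + k) ^ 3 / 2))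
    {k₂ k₃ : ℕ} (hk2 : 2 ≤ k₂) (hk23 : k₂ < k₃) (hk3K : k₃ < K) (hL3 : ∀ j, j < K → j ≠ 1 → j ≠ k₂ → j ≠ k₃ → L j = 0)
    {δ : ℝ} (hδ : 0 < δ) (hδ1 : δ ≤ 1) (hfar : (10 : ℝ) ≤ δ * k₂)
    (hpair : ∀ m, (k₂ : ℝ) * (L k₂ * h (m + k₂) ^ 3 / 2) + (k₃ : ℝ) * (L k₃ * h (m + k₃) ^ 3 / 2) ≤ 1 - δ)
    {N : ℕ} {KL : ℕ → ℕ → ℕ → ℝ}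
    (hKL : ∀ k n l, KL k n l = if 0 < k ∧ k < K ∧ l < k then L k * h (n + k) ^ 3 / 2 * ∏ t ∈ Ico (n + 1 + l) (n + k + 1), g t else 0)
    {KA : ℕ → ℕ → ℕ → ℝ} {RA : ℕ → (ℕ → ℝ) → ℕ → ℝ}
    (hRA : ∀ i v m, RA i v m = ∑ l ∈ range K, KA i m l * v (m + 1 + l))
    (hKA : ∀ i m l, KA i m l = KL i m l + KA (i + 1) m l) (hKAtop : ∀ m l, KA K m l = 0)
    {e ε : ℕ → ℝ} (he0 : ∀ m, 0 ≤ e m) (hea : ∀ m, e (m + 1) ≤ e m)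
    (hεt : ∀ m, N < m → ε m = 0) (hεrec : ∀ m, ε m = e m - RA 1 ε m) : ∀ m, 0 ≤ ε m ∧ ε m ≤ e m := by
  refine flow_nonneg_young_below_cluster hmono hL hb hlo hdom hh hf hg hgF (i := 1) (k₀ := k₂) le_rfl (by omega) (by omega)
    (fun l hl hl1 hlk => hL3 l hl hl1 (by omega) (by omega)) hδ hδ1 (by simpa using hfar) (fun m => ?_) hKL hRA hKA hKAtop he0 hea hεt hεrec
  have hsub : ({k₂, k₃} : Finset ℕ) ⊆ Ico k₂ K := by
    intro j hj
    simp only [mem_insert, mem_singleton] at hj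
    rw [mem_Ico]; rcases hj with rfl | rfl <;> omega
  rw [← sum_subset hsub (fun j hj hjn => by
    simp only [mem_insert, mem_singleton, not_or] at hjn
    rw [hL3 j (mem_Ico.mp hj).2 (by have := (mem_Ico.mp hj).1; omega) hjn.1 hjn.2]; simp), sum_pair (by omega)]
  exact hpair m

/-- **THE CENSUS THREE AGES WITH A LIGHT YOUNG PAIR AND A FAR OLD AGE (wedge R2).**  Profile carried by `{1, k₂, k₃}`, `2 ≤ k₂ < k₃ < K`; dampings of the
self-consistent class; IF `d_m + x₂(m) ≤ 1 − δ` at every pin (`d_m = L_1h_{m+1}³∕2`, `x₂(m) = k₂·L_{k₂}h_{m+k₂}³∕2`; DISPLAYED, not discharged — (E90c)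
`total_load_two_ages_le_one` gives `≤ 1` for `k₂ ≤ 133` in a two-age profile) with `0 < δ ≤ 1` and `10·k₂ ≤ δ·k₃`, THEN `0 ≤ ε ≤ e` for every admissible
excess, every horizon — whatever `d + x₂ + x₃` ((E91b) `renewal_nonneg_two_reads` with the young PAIR as the young read: `sy = 1 − δ`, `so = √2∕2`,
`V = 2√2·k₂∕k₃` from (E91a) `old_read_variation` for the age `k₃` over `d ≤ k₂` pins). [folklore] -/
theorem flow_nonneg_three_ages_far_old (hmono : ∀ u v : ℕ → ℝ, SeqBox γ u → SeqBox γ v → (∀ j, u j ≤ v j) → B u ≤ B v)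
    (hL : ∀ k, 0 ≤ L k) (hb : 0 < b) (hlo : ∀ u, SeqBox γ u → b ≤ B u) (hdom : ∀ u, SeqBox γ u → ∑ k ∈ range K, L k * u k ≤ B u)
    (hh : SeqBox γ h) (hf : MemFlow B gIR h) (hg : ∀ t, 0 < g t ∧ g t ≤ 1)
    (hgF : ∀ t, 1 ≤ g t * (1 + ∑ k ∈ range K, L k * h (t + k) ^ 3 / 2))
    {k₂ k₃ : ℕ} (hk2 : 2 ≤ k₂) (hk23 : k₂ < k₃) (hk3K : k₃ < K) (hL3 : ∀ j, j < K → j ≠ 1 → j ≠ k₂ → j ≠ k₃ → L j = 0)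
    {δ : ℝ} (hδ : 0 < δ) (hfar : (10 : ℝ) * k₂ ≤ δ * k₃)
    (hyoung : ∀ m, L 1 * h (m + 1) ^ 3 / 2 + (k₂ : ℝ) * (L k₂ * h (m + k₂) ^ 3 / 2) ≤ 1 - δ)
    {N : ℕ} {KL : ℕ → ℕ → ℕ → ℝ}
    (hKL : ∀ k n l, KL k n l = if 0 < k ∧ k < K ∧ l < k then L k * h (n + k) ^ 3 / 2 * ∏ t ∈ Ico (n + 1 + l) (n + k + 1), g t else 0)
    {KA : ℕ → ℕ → ℕ → ℝ} {RA : ℕ → (ℕ → ℝ) → ℕ → ℝ}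
    (hRA : ∀ i v m, RA i v m = ∑ l ∈ range K, KA i m l * v (m + 1 + l))
    (hKA : ∀ i m l, KA i m l = KL i m l + KA (i + 1) m l) (hKAtop : ∀ m l, KA K m l = 0)
    {e ε : ℕ → ℝ} (he0 : ∀ m, 0 ≤ e m) (hea : ∀ m, e (m + 1) ≤ e m)
    (hεt : ∀ m, N < m → ε m = 0) (hεrec : ∀ m, ε m = e m - RA 1 ε m) : ∀ m, 0 ≤ ε m ∧ ε m ≤ e m := by
  have hpos : ∀ n, 0 < h n := fun n => (hh n).1
  have hs2 : Real.sqrt 2 ^ 2 = 2 := Real.sq_sqrt (by norm_num)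
  have hs0 : 0 ≤ Real.sqrt 2 := Real.sqrt_nonneg 2
  have hs17 : Real.sqrt 2 ≤ 17 / 12 := Real.sqrt_le_iff.mpr ⟨by norm_num, by norm_num⟩
  have hK : 1 ≤ K := by omega
  have h1K : 1 < K := by omega
  have hk2K : k₂ < K := by omega
  have hk3 : 0 < k₃ := by omega
  have hk2r : (0 : ℝ) < k₂ := by exact_mod_cast (show 0 < k₂ by omega)
  have hk3r : (0 : ℝ) < k₃ := by exact_mod_cast hk3
  have hL0 : L 0 = 0 := hL3 0 (by omega) (by omega) (by omega) (by omega)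
  -- the aggregate row is the young pair's rows plus the old row
  have hKA1 : ∀ m l, KA 1 m l = (KL 1 m l + KL k₂ m l) + KL k₃ m l := by
    intro m l
    have h1 : KA 1 m l = ∑ k' ∈ Ico 1 (K - 1 + 1), KL k' m l :=
      aggregate_eq_sum (n := K - 1) hKA (fun m l => by rw [Nat.sub_add_cancel hK]; exact hKAtop m l) (show 1 ≤ K - 1 + 1 by omega) m l
    rw [h1, Nat.sub_add_cancel hK]
    have hsub : ({1, k₂, k₃} : Finset ℕ) ⊆ Ico 1 K := by
      intro j hj
      simp only [mem_insert, mem_singleton] at hj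
      rw [mem_Ico]; rcases hj with rfl | rfl | rfl <;> omega
    rw [← sum_subset hsub (fun j hj hjn => by
      simp only [mem_insert, mem_singleton, not_or] at hjn
      rw [hKL]
      split_ifs
      · rw [hL3 j (mem_Ico.mp hj).2 hjn.1 hjn.2.1 hjn.2.2]; simp
      · rfl), sum_insert (by simp only [mem_insert, mem_singleton]; omega), sum_pair (by omega)]
    ring
  -- the young pair's row sums: ≤ d_m + x₂(m) ≤ 1 − δ
  have hWy : ∀ m, ∑ l ∈ range K, (KL 1 m l + KL k₂ m l) ≤ 1 - δ := by
    intro m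
    rw [sum_add_distrib]
    have h1 := row_mass_le hL hh hg hKL h1K m
    have h2 := row_mass_le hL hh hg hKL hk2K m
    have := hyoung m
    simp only [Nat.cast_one, one_mul] at h1
    linarith
  refine renewal_nonneg_two_reads (i := k₂) (N := N) (Kw := K) (sy := 1 - δ) (so := Real.sqrt 2 / 2) (V := 2 * Real.sqrt 2 * k₂ / k₃)
    (wy := fun m l => KL 1 m l + KL k₂ m l) (wo := fun m l => KL k₃ m l)
    (Y := fun m => ∑ l ∈ range K, (KL 1 m l + KL k₂ m l) * ε (m + 1 + l)) (O := fun m => ∑ l ∈ range K, KL k₃ m l * ε (m + 1 + l))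
    (fun m l => add_nonneg (kernel_entry_le hL hh hg hKL 1 m l).1 (kernel_entry_le hL hh hg hKL k₂ m l).1)
    (fun m l hl => by rw [hKL, if_neg (by omega), hKL, if_neg (by omega), add_zero]) hWy
    (fun m l => (kernel_entry_le hL hh hg hKL k₃ m l).1)
    (fun m => (row_mass_le hL hh hg hKL hk3K m).trans (window_load_le_sqrt_two_div_two hmono hL hb hlo hdom hh hf hk3K m))
    (by linarith) (by linarith [hs17]) (by positivity) ?_ (fun _ => rfl) (fun _ => rfl) he0 hea ?_ hεt ?_
  · -- (1−δ)·(2√2 k₂∕k₃) ≤ δ·(1 − √2∕2)  ⟸  10 k₂ ≤ δ k₃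
    rw [show (1 : ℝ) - (1 - δ) = δ by ring]
    have h1 : (1 - δ) * (2 * Real.sqrt 2 * k₂ / k₃) = ((1 - δ) * (2 * Real.sqrt 2) * k₂) / k₃ := by ring
    rw [h1, div_le_iff₀ hk3r]
    have h2 : (1 - δ) * (2 * Real.sqrt 2) * k₂ ≤ 2 * Real.sqrt 2 * k₂ := by
      have : 0 ≤ δ * (2 * Real.sqrt 2) * k₂ := by positivity
      nlinarith
    have h3 : 2 * Real.sqrt 2 ≤ (1 - Real.sqrt 2 / 2) * 10 := by nlinarith [hs17]
    have h4 : 2 * Real.sqrt 2 * k₂ ≤ (1 - Real.sqrt 2 / 2) * (10 * k₂) := by nlinarith [h3]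
    have h5 : (1 - Real.sqrt 2 / 2) * (10 * k₂) ≤ (1 - Real.sqrt 2 / 2) * (δ * k₃) :=
      mul_le_mul_of_nonneg_left hfar (by linarith [hs17])
    linarith
  · -- the old read varies slowly over the young pair's window (d ≤ k₂ < k₃)
    intro m d hd1 hdk2 IH
    have hdk3 : d ≤ k₃ := by omega
    have hv := old_read_variation hmono hL hb hlo hdom hh hf hL0 hg hgF hKL hk3 hk3K hd1 hdk3 he0 hea IH
    have hx := window_load_le_sqrt_two_div_two hmono hL hb hlo hdom hh hf hk3K m
    have hc0 : 0 ≤ L k₃ * h (m + k₃) ^ 3 / 2 := by have := hL k₃; have := hpos (m + k₃); positivity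
    have hem := he0 m
    have hdr : (d : ℝ) ≤ k₂ := by exact_mod_cast hdk2
    -- 4 d c₃ ≤ 4 k₂ c₃ = (4k₂∕k₃)(k₃ c₃) ≤ (4k₂∕k₃)(√2∕2) = 2√2 k₂∕k₃
    have h4 : 4 * (d : ℝ) * (L k₃ * h (m + k₃) ^ 3 / 2) * e m ≤ 2 * Real.sqrt 2 * k₂ / k₃ * e m := by
      refine mul_le_mul_of_nonneg_right ?_ hem
      rw [le_div_iff₀ hk3r]
      nlinarith [mul_le_mul_of_nonneg_right hdr hc0]
    simpa using hv.trans h4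
  · intro m
    rw [hεrec m, hRA]
    have : ∑ l ∈ range K, KA 1 m l * ε (m + 1 + l)
        = ∑ l ∈ range K, (KL 1 m l + KL k₂ m l) * ε (m + 1 + l) + ∑ l ∈ range K, KL k₃ m l * ε (m + 1 + l) := by
      rw [← sum_add_distrib]; exact sum_congr rfl fun l _ => by rw [hKA1]; ring
    rw [this]; ring

end Summit.QuantumFields.BalabanUV.Beta.EriceRemainderEnclosureHistoryAutonomyComparisonAgeCompositionYoungBelowCluster

end
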